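import Summits.KontsevichZagierPeriods.KontsevichZagierPeriods.Theorems.ZagierDilogarithmConjecture.Negative.DehnInvariant

/-!
# `ZagierDilogarithmConjecture` (stmt-KontsevichZagierPeriods-10550) — negative knowledge III: the witness `(2 ∓ 4i)/5` is outside the relator span

`q = (2 + i)/(2 − i) = (3 + 4i)/5` is unimodular and NOT a root of unity (`(2+i)ⁿ ≠ (2−i)ⁿ`,
coprimality of `2 ± i` in `ℤ[i]`, `gaussInt_pow_ne`); `z₀ = 1 − q = (2 − 4i)/5` has
`|z₀|² = 4/5 < 1`. Hence `z₀, q` are multiplicatively independent in the two ways needed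
(`indep_z₀_q`, `indep_q_z₀`), characters `uu, vv : ℂˣ → ℚ` with `uu(z₀) = 1, uu(q) = 0`,
`vv(q) = 1, vv(z₀) = 0` exist (Part II), and the Dehn-type invariant takes the values
`δ[z₀] = 2`, `δ[z̄₀] = −2` (`asym_z₀`, `asym_conj_z₀`). Consequently
`of_z₀_not_mem`, `of_conj_z₀_not_mem : [(2 ∓ 4i)/5] ∉ AddSubgroup.closure dilogRelators` —
the relator subgroup of Zagier's conjecture is proper even on the algebraic upper half plane.
Sorry-free, axioms ⊆ {propext, Classical.choice, Quot.sound}.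
-/

noncomputable section

open Complex MeasureTheory Set
open scoped ComplexConjugate

namespace Summit.KontsevichZagierPeriods.HyperbolicBloch.ZagierDilogarithmConjectureNegative

open Literature.NumberTheory.Transcendental
open Summit.KontsevichZagierPeriods.KontsevichZagierPeriods.Theses.HyperbolicBloch
  (ZagierDilogarithmConjecture)
open Summit.KontsevichZagierPeriods.HyperbolicBloch.FiveTermTransferNegative
  (L not_isAlgebraic_L xL xL_re xL_im not_isAlgebraic_xL isAlgebraic_of_eq_rat)

/-! ### The witness `q = (2 + i)/(2 − i) = (3 + 4i)/5` and `z₀ = 1 − q = (2 − 4i)/5` -/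

/-- `q = (2 + i)/(2 − i)`, a unimodular Gaussian rational which is not a root of unity. -/
def q : ℂ := (2 + I) / (2 - I)

/-- Auxiliary: `two_add_I_ne_zero`. [folklore] -/
theorem two_add_I_ne_zero : (2 + I : ℂ) ≠ 0 := fun e => by simpa using congrArg Complex.re e
/-- Auxiliary: `two_sub_I_ne_zero`. [folklore] -/
theorem two_sub_I_ne_zero : (2 - I : ℂ) ≠ 0 := fun e => by simpa using congrArg Complex.re e

/-- Auxiliary: `q_ne_zero`. [folklore] -/
theorem q_ne_zero : q ≠ 0 := div_ne_zero two_add_I_ne_zero two_sub_I_ne_zero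

/-- Auxiliary: `q_eq`. [folklore] -/
theorem q_eq : q = (3 + 4 * I) / 5 := by
  unfold q
  rw [div_eq_div_iff two_sub_I_ne_zero (by norm_num)]
  ring_nf
  rw [I_sq]
  ring

/-- Auxiliary: `q_re`. [folklore] -/
theorem q_re : q.re = 3 / 5 := by
  rw [q_eq]; simp
/-- Auxiliary: `q_im`. [folklore] -/
theorem q_im : q.im = 4 / 5 := by
  rw [q_eq]; simp

/-- Auxiliary: `conj_two_add_I`. [folklore] -/
theorem conj_two_add_I : conj (2 + I : ℂ) = 2 - I := by
  rw [map_add, map_ofNat, Complex.conj_I, ← sub_eq_add_neg]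
/-- Auxiliary: `conj_two_sub_I`. [folklore] -/
theorem conj_two_sub_I : conj (2 - I : ℂ) = 2 + I := by
  rw [map_sub, map_ofNat, Complex.conj_I, sub_neg_eq_add]

/-- Auxiliary: `norm_q`. [folklore] -/
theorem norm_q : ‖q‖ = 1 := by
  unfold q
  rw [norm_div, ← conj_two_add_I, Complex.norm_conj, div_self]
  exact norm_ne_zero_iff.mpr two_add_I_ne_zero

/-- Auxiliary: `conj_q`. [folklore] -/
theorem conj_q : conj q = q⁻¹ := by
  unfold q
  rw [map_div₀, conj_two_add_I, conj_two_sub_I, inv_div]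

/-- `2 + i` and `2 − i` are coprime Gaussian primes of norm `5`; so `(2+i)^n ≠ (2−i)^n` for
`n ≥ 1`. [folklore] -/
theorem gaussInt_pow_ne {n : ℕ} (hn : n ≠ 0) :
    (⟨2, 1⟩ : GaussianInt) ^ n ≠ (⟨2, -1⟩ : GaussianInt) ^ n := by
  intro e
  have hcop : IsCoprime (⟨2, -1⟩ : GaussianInt) (⟨2, 1⟩ : GaussianInt) :=
    ⟨⟨1, 1⟩, -1, by decide⟩
  have hdvd : (⟨2, -1⟩ : GaussianInt) ∣ (⟨2, 1⟩ : GaussianInt) ^ n := by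
    rw [e]
    exact dvd_pow_self _ hn
  have hunit : IsUnit (⟨2, -1⟩ : GaussianInt) :=
    (hcop.pow_right (n := n)).isUnit_of_dvd' (dvd_refl _) hdvd
  rw [Zsqrtd.isUnit_iff_norm_isUnit, Zsqrtd.norm_def] at hunit
  rcases Int.isUnit_iff.mp hunit with h | h <;> norm_num at h

/-- Auxiliary: `two_add_I_pow_ne`. [folklore] -/
theorem two_add_I_pow_ne {n : ℕ} (hn : n ≠ 0) : (2 + I : ℂ) ^ n ≠ (2 - I) ^ n := by
  intro e
  apply gaussInt_pow_ne hn
  apply GaussianInt.toComplex_injective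
  have h1 : GaussianInt.toComplex (⟨2, 1⟩ : GaussianInt) = 2 + I := by
    rw [GaussianInt.toComplex_def']; push_cast; ring
  have h2 : GaussianInt.toComplex (⟨2, -1⟩ : GaussianInt) = 2 - I := by
    rw [GaussianInt.toComplex_def']; push_cast; ring
  rw [map_pow, map_pow, h1, h2, e]

/-- `q` is not a root of unity: `q ^ b = 1` forces `b = 0` (`b : ℤ`). [folklore] -/
theorem q_zpow_eq_one {b : ℤ} (h : q ^ b = 1) : b = 0 := by
  have key : ∀ n : ℕ, q ^ n = 1 → n = 0 := by
    intro n hn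
    by_contra hne
    apply two_add_I_pow_ne hne
    unfold q at hn
    rw [div_pow, div_eq_one_iff_eq (pow_ne_zero n two_sub_I_ne_zero)] at hn
    exact hn
  rcases Int.natAbs_eq b with hb | hb
  · rw [hb] at h ⊢
    rw [zpow_natCast] at h
    simp [key _ h]
  · rw [hb] at h ⊢
    rw [zpow_neg, zpow_natCast, inv_eq_one] at h
    simp [key _ h]

/-- The witness point `z₀ = 1 − q = (2 − 4i)/5` of the LOWER half plane. -/
def z₀ : ℂ := 1 - q

/-- Auxiliary: `z₀_eq`. [folklore] -/
theorem z₀_eq : z₀ = (2 - 4 * I) / 5 := by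
  rw [z₀, q_eq]; ring

/-- Auxiliary: `z₀_re`. [folklore] -/
theorem z₀_re : z₀.re = 2 / 5 := by rw [z₀, sub_re, one_re, q_re]; norm_num
/-- Auxiliary: `z₀_im`. [folklore] -/
theorem z₀_im : z₀.im = -(4 / 5) := by rw [z₀, sub_im, one_im, q_im]; norm_num

/-- Auxiliary: `z₀_ne_zero`. [folklore] -/
theorem z₀_ne_zero : z₀ ≠ 0 := fun e => by
  have := congrArg Complex.re e; rw [z₀_re] at this; norm_num at this

/-- Auxiliary: `one_sub_z₀`. [folklore] -/
theorem one_sub_z₀ : 1 - z₀ = q := by rw [z₀]; ring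

/-- Auxiliary: `normSq_z₀`. [folklore] -/
theorem normSq_z₀ : Complex.normSq z₀ = 4 / 5 := by
  rw [Complex.normSq_apply, z₀_re, z₀_im]; norm_num

/-- Auxiliary: `norm_z₀_lt_one`. [folklore] -/
theorem norm_z₀_lt_one : ‖z₀‖ < 1 := by
  have h : ‖z₀‖ ^ 2 < 1 := by
    rw [← Complex.normSq_eq_norm_sq, normSq_z₀]; norm_num
  nlinarith [norm_nonneg z₀]

/-- Auxiliary: `norm_z₀_pos`. [folklore] -/
theorem norm_z₀_pos : 0 < ‖z₀‖ := norm_pos_iff.mpr z₀_ne_zero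

/-- Multiplicative independence I: `z₀ ^ a * q ^ b = 1 → a = 0` (take absolute values:
`|q| = 1`, `0 < |z₀| < 1`). [folklore] -/
theorem indep_z₀_q {a b : ℤ} (h : z₀ ^ a * q ^ b = 1) : a = 0 := by
  have e := congrArg (fun w : ℂ => ‖w‖) h
  simp only [norm_mul, norm_zpow, norm_q, one_zpow, mul_one, norm_one] at e
  have hanti : StrictAnti fun n : ℤ => ‖z₀‖ ^ n := zpow_right_strictAnti₀ norm_z₀_pos norm_z₀_lt_one
  have e0 : (fun n : ℤ => ‖z₀‖ ^ n) a = (fun n : ℤ => ‖z₀‖ ^ n) 0 := by simpa using e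
  exact hanti.injective e0

/-- Multiplicative independence II: `q ^ a * z₀ ^ b = 1 → a = 0` (absolute values give `b = 0`,
then `q` is not a root of unity). [folklore] -/
theorem indep_q_z₀ {a b : ℤ} (h : q ^ a * z₀ ^ b = 1) : a = 0 := by
  have hb : b = 0 := indep_z₀_q (a := b) (b := a) (by rw [mul_comm]; exact h)
  subst hb
  rw [zpow_zero, mul_one] at h
  exact q_zpow_eq_one h

/-- The two generators of `Additive ℂˣ` we prescribe values on. -/
def gz : Additive ℂˣ := Additive.ofMul (Units.mk0 z₀ z₀_ne_zero)
/-- Auxiliary definition `gq` (see the module docstring, §5). [folklore] -/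
def gq : Additive ℂˣ := Additive.ofMul (Units.mk0 q q_ne_zero)

/-- An additive character `u` of `ℂˣ` with `u(z₀) = 1`, `u(q) = 0`. -/
theorem exists_u : ∃ u : Additive ℂˣ →+ ℚ, u gz = 1 ∧ u gq = 0 :=
  exists_addMonoidHom_eq_one_eq_zero gz gq fun _ _ H => indep_z₀_q (zpow_mul_zpow_eq_one_of_smul _ _ H)

/-- An additive character `v` of `ℂˣ` with `v(q) = 1` (and `v(z₀) = 0`). -/
theorem exists_v : ∃ v : Additive ℂˣ →+ ℚ, v gq = 1 ∧ v gz = 0 :=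
  exists_addMonoidHom_eq_one_eq_zero gq gz fun _ _ H => indep_q_z₀ (zpow_mul_zpow_eq_one_of_smul _ _ H)

/-- The chosen characters. -/
def uu : Additive ℂˣ →+ ℚ := exists_u.choose
/-- Auxiliary definition `vv` (see the module docstring, §5). [folklore] -/
def vv : Additive ℂˣ →+ ℚ := exists_v.choose

/-- Auxiliary: `ext_uu_z₀`. [folklore] -/
theorem ext_uu_z₀ : ext uu z₀ = 1 := by rw [ext_of_ne uu z₀_ne_zero]; exact exists_u.choose_spec.1
/-- Auxiliary: `ext_uu_q`. [folklore] -/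
theorem ext_uu_q : ext uu q = 0 := by rw [ext_of_ne uu q_ne_zero]; exact exists_u.choose_spec.2
/-- Auxiliary: `ext_vv_q`. [folklore] -/
theorem ext_vv_q : ext vv q = 1 := by rw [ext_of_ne vv q_ne_zero]; exact exists_v.choose_spec.1
/-- Auxiliary: `ext_vv_z₀`. [folklore] -/
theorem ext_vv_z₀ : ext vv z₀ = 0 := by rw [ext_of_ne vv z₀_ne_zero]; exact exists_v.choose_spec.2

/-- **The invariant does not vanish at `z₀`**: `δ[z₀] = 2`. Computation: `1 − z₀ = q`,
`z̄₀ = −z₀/q`, `1 − z̄₀ = q̄ = q⁻¹` (`|q| = 1`), so `ψ(z₀) = 2 (u(z₀) v(q) − v(z₀) u(q)) = 2`.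
[folklore] -/
theorem asym_z₀ : asym uu vv z₀ = 2 := by
  have hc : conj z₀ = -z₀ / q := by
    rw [z₀, map_sub, map_one, conj_q]
    field_simp [q_ne_zero]
    ring
  have hc1 : 1 - conj z₀ = q⁻¹ := by
    rw [z₀, map_sub, map_one, conj_q]; ring
  simp only [asym, sym]
  rw [one_sub_z₀, hc1, hc, ext_div uu (neg_ne_zero.mpr z₀_ne_zero) q_ne_zero,
    ext_div vv (neg_ne_zero.mpr z₀_ne_zero) q_ne_zero, ext_neg uu z₀_ne_zero,
    ext_neg vv z₀_ne_zero, ext_inv uu q_ne_zero, ext_inv vv q_ne_zero,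
    ext_uu_z₀, ext_uu_q, ext_vv_q, ext_vv_z₀]
  norm_num

/-- Hence `δ[z̄₀] = −2` for the mirror point `z̄₀ = (2 + 4i)/5` of the UPPER half plane. -/
theorem asym_conj_z₀ : asym uu vv (conj z₀) = -2 := by
  have h := asym_z₀
  simp only [asym, conj_conj] at h ⊢
  linarith

/-- **`[z₀] ∉` the relator subgroup** (`z₀ = (2 − 4i)/5`, lower half plane). [folklore] -/
theorem of_z₀_not_mem : FreeAbelianGroup.of z₀ ∉ AddSubgroup.closure dilogRelators := by
  intro h
  have := dehn_eq_zero_of_mem_closure uu vv h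
  rw [dehn_of, asym_z₀] at this
  norm_num at this

/-- **`[z̄₀] ∉` the relator subgroup** (`z̄₀ = (2 + 4i)/5`, upper half plane): the relator
subgroup is PROPER even on the algebraic upper half plane — the conclusion of the crux is not
vacuous. [folklore] -/
theorem of_conj_z₀_not_mem :
    FreeAbelianGroup.of (conj z₀) ∉ AddSubgroup.closure dilogRelators := by
  intro h
  have := dehn_eq_zero_of_mem_closure uu vv h
  rw [dehn_of, asym_conj_z₀] at this
  norm_num at this

end Summit.KontsevichZagierPeriods.HyperbolicBloch.ZagierDilogarithmConjectureNegative

end
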